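import Summits.PneNP.PneNP.Theorems.RootDecompSegregatorSmallSegregators.Negative.KSS3

/-!
# K\*\* — proofs 4/6 (`KSS4`)

Proof file 4/6 of the kernel refutation of the route item `RootDecompSegregator.SmallSegregators`
(stmt-PneNP-26297; deciding theorem `Summit.PneNP.PneNP.Theorems.RootDecompSegregatorSmallSegregators_refuted`
in `Theorems/RootDecompSegregatorSmallSegregatorsRefutation.lean`; definitions in `Defs.lean` of this
directory).  Topic: lemmas `nblk_mul_bsz` … `arcInit_coord`.

PROVENANCE.  Mathematics and Lean text by the decomp-pnenp cell's lens-1 lineage (work file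
`decomp-pnenp-lens-1/SegregatorPageThreshold.lean`, generations 4–5, v5 sha256 `099856e2…`, brief
`KSS-DoubleButterfly.md`): the dependency cone of its theorem `not_smallSegregators`, extracted verbatim by
the cell critic and split into files of at most 400 lines (docstrings added where missing).  No declaration
here mentions a Theses item; the chain ends in `ancestorRobust_three : AncestorRobust 3 160 12` (last file),
from which the flat refutation file concludes `¬ SmallSegregators` by the kill switch
`not_smallSegregatorsAt_of_ancestorRobust` at `r = 3`, `k = 172`.
-/

namespace Summit.PneNP.PneNP.Theorems.RootDecompSegregatorSmallSegregators.Negative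

open Relation
open StackOp

namespace TSB

section Schedule

/-! #### Sizes and lengths -/

/-- K\*\* cone (auxiliary lemma): `nblk_mul_bsz`. -/
theorem nblk_mul_bsz {L : ℕ} (hL : 1 ≤ L) (lam : ℕ) : nblk L lam * bsz L lam = 2 ^ L := by
  unfold nblk bsz
  rw [← pow_add]
  congr 1
  have := Nat.mod_lt lam (by omega : 0 < L)
  omega

/-- K\*\* cone (auxiliary lemma): `bsz_pos`. -/
theorem bsz_pos (L lam : ℕ) : 0 < bsz L lam := by unfold bsz; positivity

/-- K\*\* cone (auxiliary lemma): `length_blkU`. -/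
@[simp] theorem length_blkU (B : ℕ) : (blkU B).length = 3 * B := by simp [blkU]; ring

/-- K\*\* cone (auxiliary lemma): `length_blkV`. -/
@[simp] theorem length_blkV (B : ℕ) : (blkV B).length = 3 * B := by simp [blkV]; ring

/-- K\*\* cone (auxiliary lemma): `length_blkI`. -/
@[simp] theorem length_blkI (B : ℕ) : (blkI B).length = 3 * B := by simp [blkI]; ring

/-- K\*\* cone (auxiliary lemma): `length_levU`. -/
theorem length_levU {L : ℕ} (hL : 1 ≤ L) (lam : ℕ) : (levU L lam).length = 3 * 2 ^ L := by
  unfold levU; rw [length_flatten_replicate, length_blkU, ← nblk_mul_bsz hL lam]; ring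

/-- K\*\* cone (auxiliary lemma): `length_levV`. -/
theorem length_levV {L : ℕ} (hL : 1 ≤ L) (lam : ℕ) : (levV L lam).length = 3 * 2 ^ L := by
  unfold levV; rw [length_flatten_replicate, length_blkV, ← nblk_mul_bsz hL lam]; ring

/-- K\*\* cone (auxiliary lemma): `length_levI`. -/
theorem length_levI {L : ℕ} (hL : 1 ≤ L) (lam : ℕ) : (levI L lam).length = 3 * 2 ^ L := by
  unfold levI; rw [length_flatten_replicate, length_blkI, ← nblk_mul_bsz hL lam]; ring

/-- K\*\* cone (auxiliary lemma): `length_levX`. -/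
theorem length_levX {L : ℕ} (hL : 1 ≤ L) (par lam : ℕ) : (levX L par lam).length = 3 * 2 ^ L := by
  unfold levX; split_ifs; exacts [length_levI hL lam, length_levV hL lam]

/-- K\*\* cone (auxiliary lemma): `length_initX`. -/
@[simp] theorem length_initX (L par : ℕ) : (initX L par).length = 2 ^ L := by
  unfold initX; split_ifs <;> simp

/-- K\*\* cone (auxiliary lemma): `padLen_spec`. -/
theorem padLen_spec (L : ℕ) : 2 ^ L + 2 * L * (3 * 2 ^ L) + padLen L = dbT L := by
  unfold padLen dbT
  have : 2 ^ L + 6 * 2 ^ L * L ≤ 10 * 2 ^ L * L + 2 * 2 ^ L := by nlinarith [Nat.one_le_two_pow (n := L)]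
  have e : 2 * L * (3 * 2 ^ L) = 6 * 2 ^ L * L := by ring
  omega

/-- K\*\* cone (auxiliary lemma): `length_trU`. -/
theorem length_trU {L : ℕ} (hL : 1 ≤ L) : (trU L).length = dbT L := by
  unfold trU
  rw [List.length_append, List.length_append, List.length_replicate, List.length_replicate,
    length_flatten_range_const _ (3 * 2 ^ L) _ (fun i _ => length_levU hL i)]
  exact padLen_spec L

/-- K\*\* cone (auxiliary lemma): `length_trX`. -/
theorem length_trX {L : ℕ} (hL : 1 ≤ L) (par : ℕ) : (trX L par).length = dbT L := by
  unfold trX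
  rw [List.length_append, List.length_append, length_initX, List.length_replicate,
    length_flatten_range_const _ (3 * 2 ^ L) _ (fun i _ => length_levX hL par i)]
  exact padLen_spec L

/-- K\*\* cone (auxiliary lemma): `length_levels_lt`. -/
theorem length_levels_lt {L : ℕ} (f : ℕ → List StackOp)
    (hf : ∀ i, (f i).length = 3 * 2 ^ L) (k : ℕ) :
    ((List.range k).map f).flatten.length = k * (3 * 2 ^ L) :=
  length_flatten_range_const f _ k (fun i _ => hf i)

/-! #### Times -/

/-- K\*\* cone (auxiliary lemma): `posOf_lt`. -/
theorem posOf_lt {L lam x : ℕ} (hx : x < 2 ^ L) : posOf L lam x < 2 ^ L := by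
  unfold posOf; split_ifs <;> omega

/-- K\*\* cone (auxiliary lemma): `posOf_posOf`. -/
theorem posOf_posOf {L lam x : ℕ} (hx : x < 2 ^ L) : posOf L lam (posOf L lam x) = x := by
  unfold posOf; split_ifs <;> omega

/-- Block bookkeeping for a position `q < 2^L`: `q = j*B + i`, `(j+1)*B ≤ 2^L`. -/
theorem block_decomp {L : ℕ} (hL : 1 ≤ L) (lam : ℕ) {q : ℕ} (hq : q < 2 ^ L) :
    q / bsz L lam * bsz L lam + q % bsz L lam = q ∧ q % bsz L lam < bsz L lam ∧
      (q / bsz L lam + 1) * bsz L lam ≤ 2 ^ L ∧ q / bsz L lam < nblk L lam := by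
  have hB := bsz_pos L lam
  have hMB := nblk_mul_bsz hL lam
  refine ⟨Nat.div_add_mod' q _, Nat.mod_lt _ hB, ?_, ?_⟩
  · have hj : q / bsz L lam < nblk L lam := by
      rw [Nat.div_lt_iff_lt_mul hB, hMB]; exact hq
    calc (q / bsz L lam + 1) * bsz L lam ≤ nblk L lam * bsz L lam := Nat.mul_le_mul_right _ hj
      _ = 2 ^ L := hMB
  · rw [Nat.div_lt_iff_lt_mul hB, hMB]; exact hq

end Schedule

/-! #### Block splits in additive coordinates (`B = i + 1 + r`, `nblk = j + 1 + m`) -/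

section Arcs

/-- K\*\* cone (auxiliary lemma): `rep_split`. -/
theorem rep_split (a : StackOp) (i r : ℕ) :
    List.replicate (i + 1 + r) a = List.replicate i a ++ a :: List.replicate r a := by
  rw [Nat.add_assoc, List.replicate_add, List.replicate_add]
  simp

/-- K\*\* cone (auxiliary lemma): `rep_split'`. -/
theorem rep_split' (a : StackOp) (i r : ℕ) :
    List.replicate (i + 1 + r) a = List.replicate r a ++ a :: List.replicate i a := by
  rw [show i + 1 + r = r + 1 + i by ring]; exact rep_split a r i

/-- K\*\* cone (auxiliary lemma): `flatten_rep_split3`. -/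
theorem flatten_rep_split3 {α : Type*} (l : List α) (j m : ℕ) :
    (List.replicate (j + 1 + m) l).flatten =
      (List.replicate j l).flatten ++ l ++ (List.replicate m l).flatten := by
  rw [flatten_replicate_split l (show j < j + 1 + m by omega), show j + 1 + m - j - 1 = m by omega]

/-- U block, P-push `i` ↔ C-pop `r`. -/
theorem blkU_split (i r : ℕ) : blkU (i + 1 + r) = List.replicate i push ++ push ::
    ((List.replicate r push ++ List.replicate (i + 1 + r) skip ++ List.replicate r pop) ++
      pop :: List.replicate i pop) := by
  unfold blkU
  rw [rep_split push i r, rep_split' pop i r]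
  simp only [List.append_assoc, List.cons_append]

/-- V block, P-push `i` ↔ Q-pop `r`. -/
theorem blkV_splitPQ (i r : ℕ) : blkV (i + 1 + r) = List.replicate i push ++ push ::
    ((List.replicate r push ++ List.replicate r pop) ++
      pop :: (List.replicate i pop ++ List.replicate (i + 1 + r) push)) := by
  unfold blkV
  nth_rewrite 1 [rep_split push i r]
  rw [rep_split' pop i r]
  simp only [List.append_assoc, List.cons_append]

/-- V block, C-push `i'` (the birth push; its pop lies in the next level). -/
theorem blkV_splitC (i r : ℕ) : blkV (i + 1 + r) =
    (List.replicate (i + 1 + r) push ++ List.replicate (i + 1 + r) pop ++ List.replicate i push) ++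
      push :: List.replicate r push := by
  unfold blkV
  nth_rewrite 2 [rep_split push i r]
  simp only [List.append_assoc]

/-- I block, Q-push `r` ↔ C-pop `i`. -/
theorem blkI_splitQC (i r : ℕ) : blkI (i + 1 + r) =
    (List.replicate (i + 1 + r) pop ++ List.replicate r push) ++ push ::
      ((List.replicate i push ++ List.replicate i pop) ++ pop :: List.replicate r pop) := by
  unfold blkI
  rw [rep_split' push i r]
  nth_rewrite 2 [rep_split pop i r]
  simp only [List.append_assoc, List.cons_append]

/-- I block, P-pop `i` (popping the birth push of the previous level). -/
theorem blkI_splitP (i r : ℕ) : blkI (i + 1 + r) = List.replicate i pop ++ pop ::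
    (List.replicate r pop ++ List.replicate (i + 1 + r) push ++ List.replicate (i + 1 + r) pop) := by
  unfold blkI
  nth_rewrite 1 [rep_split pop i r]
  simp only [List.append_assoc, List.cons_append]

/-! #### PD facts for blocks -/

/-- K\*\* cone (auxiliary lemma): `PD_blkV`. -/
theorem PD_blkV (B : ℕ) : PD 0 (blkV B) := by
  unfold blkV
  refine PD_append (PD_append (PD_replicate_push 0 B) (e := B) (by simp [List.count_replicate])
    (PD_replicate_pop le_rfl)) (e := 0) (by simp [List.count_replicate]) (PD_replicate_push 0 B)

/-- K\*\* cone (auxiliary lemma): `count_blkV`. -/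
theorem count_blkV (B : ℕ) : (blkV B).count pop = B ∧ (blkV B).count push = B + B := by
  simp [blkV, List.count_replicate]

/-- K\*\* cone (auxiliary lemma): `PD_blkI`. -/
theorem PD_blkI {B d : ℕ} (h : B ≤ d) : PD d (blkI B) := by
  unfold blkI
  refine PD_append (PD_append (PD_replicate_pop h) (e := d - B) (by simp [List.count_replicate]; omega)
    (PD_replicate_push _ B)) (e := d) (by simp [List.count_replicate]) (PD_replicate_pop h)

/-- K\*\* cone (auxiliary lemma): `count_blkI`. -/
theorem count_blkI (B : ℕ) : (blkI B).count pop = B + B ∧ (blkI B).count push = B := by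
  simp [blkI, List.count_replicate]

/-! #### The four arc families -/

variable {L : ℕ}

/-- (A4) on `U`: P-push → partner C-pop. -/
theorem arcU_coord (hL : 1 ≤ L) {lam : ℕ} (hlam : lam < 2 * L) {B j m i r : ℕ}
    (hB : bsz L lam = B) (hn : nblk L lam = j + 1 + m) (hir : B = i + 1 + r) :
    (base L lam + 3 * B * j + i, base L lam + 3 * B * j + 2 * B + r) ∈ lifoArcs (trU L) 0 [] := by
  set PRE := List.replicate (2 ^ L) skip ++ ((List.range lam).map (levU L)).flatten ++
    (List.replicate j (blkU B)).flatten ++ List.replicate i push with hPRE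
  set MID := List.replicate r push ++ List.replicate B skip ++ List.replicate r pop with hMID
  set POST := List.replicate i pop ++ (List.replicate m (blkU B)).flatten ++
    ((List.range (2 * L - lam - 1)).map (fun k => levU L (lam + 1 + k))).flatten ++
    List.replicate (padLen L) skip with hPOST
  have hdec : trU L = PRE ++ push :: (MID ++ pop :: POST) := by
    rw [trU, flatten_range_split (levU L) hlam,
      show levU L lam = (List.replicate (j + 1 + m) (blkU B)).flatten by rw [levU, hB, hn],
      flatten_rep_split3 (blkU B) j m]
    nth_rewrite 2 [show blkU B = _ from hir ▸ blkU_split i r]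
    simp only [hPRE, hMID, hPOST, List.append_assoc, List.cons_append]
  have hPD : PD 0 MID := by
    rw [hMID]
    exact PD_append (PD_append (PD_replicate_push 0 r) (e := r) (by simp [List.count_replicate])
      (PD_replicate_skip r _)) (e := r) (by simp [List.count_replicate]) (PD_replicate_pop le_rfl)
  have hbal : MID.count pop = MID.count push := by simp [hMID, List.count_replicate]
  have hmem := mem_lifoArcs_match PRE MID POST 0 [] hPD hbal
  rw [← hdec] at hmem
  have h1 : PRE.length = base L lam + 3 * B * j + i := by
    simp [hPRE, base, length_levels_lt _ (length_levU hL)]; ring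
  have h2 : MID.length = r + B + r := by
    simp only [hMID, List.length_append, List.length_replicate]
  rw [zero_add, h1, h2] at hmem
  convert hmem using 2
  omega

/-- (A2) on the V-role stack of level `lam` (`trX par` with `lam % 2 ≠ par`): P-push → Q-pop. -/
theorem arcV_coord (hL : 1 ≤ L) {par lam : ℕ} (hpar : lam % 2 ≠ par) (hlam : lam < 2 * L)
    {B j m i r : ℕ} (hB : bsz L lam = B) (hn : nblk L lam = j + 1 + m) (hir : B = i + 1 + r) :
    (base L lam + 3 * B * j + i, base L lam + 3 * B * j + B + r) ∈ lifoArcs (trX L par) 0 [] := by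
  set PRE := initX L par ++ ((List.range lam).map (levX L par)).flatten ++
    (List.replicate j (blkV B)).flatten ++ List.replicate i push with hPRE
  set MID := List.replicate r push ++ List.replicate r pop with hMID
  set POST := (List.replicate i pop ++ List.replicate B push) ++
    (List.replicate m (blkV B)).flatten ++
    ((List.range (2 * L - lam - 1)).map (fun k => levX L par (lam + 1 + k))).flatten ++
    List.replicate (padLen L) skip with hPOST
  have hdec : trX L par = PRE ++ push :: (MID ++ pop :: POST) := by
    rw [trX, flatten_range_split (levX L par) hlam,
      show levX L par lam = (List.replicate (j + 1 + m) (blkV B)).flatten by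
        rw [levX, if_neg hpar, levV, hB, hn],
      flatten_rep_split3 (blkV B) j m]
    nth_rewrite 2 [show blkV B = _ from hir ▸ blkV_splitPQ i r]
    simp only [hPRE, hMID, hPOST, List.append_assoc, List.cons_append]
  have hPD : PD 0 MID := by
    rw [hMID]
    exact PD_append (PD_replicate_push 0 r) (e := r) (by simp [List.count_replicate])
      (PD_replicate_pop le_rfl)
  have hbal : MID.count pop = MID.count push := by simp [hMID, List.count_replicate]
  have hmem := mem_lifoArcs_match PRE MID POST 0 [] hPD hbal
  rw [← hdec] at hmem
  have h1 : PRE.length = base L lam + 3 * B * j + i := by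
    simp [hPRE, base, length_levels_lt _ (length_levX hL par)]; ring
  have h2 : MID.length = r + r := by
    simp only [hMID, List.length_append, List.length_replicate]
  rw [zero_add, h1, h2] at hmem
  convert hmem using 2
  omega

/-- (A3) on the IN-role stack of level `lam` (`trX par` with `lam % 2 = par`): Q-push → C-pop. -/
theorem arcI_coord (hL : 1 ≤ L) {par lam : ℕ} (hpar : lam % 2 = par) (hlam : lam < 2 * L)
    {B j m i r : ℕ} (hB : bsz L lam = B) (hn : nblk L lam = j + 1 + m) (hir : B = i + 1 + r) :
    (base L lam + 3 * B * j + B + r, base L lam + 3 * B * j + 2 * B + i) ∈ lifoArcs (trX L par) 0 [] := by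
  set PRE := initX L par ++ ((List.range lam).map (levX L par)).flatten ++
    (List.replicate j (blkI B)).flatten ++ (List.replicate B pop ++ List.replicate r push)
    with hPRE
  set MID := List.replicate i push ++ List.replicate i pop with hMID
  set POST := List.replicate r pop ++ (List.replicate m (blkI B)).flatten ++
    ((List.range (2 * L - lam - 1)).map (fun k => levX L par (lam + 1 + k))).flatten ++
    List.replicate (padLen L) skip with hPOST
  have hdec : trX L par = PRE ++ push :: (MID ++ pop :: POST) := by
    rw [trX, flatten_range_split (levX L par) hlam,
      show levX L par lam = (List.replicate (j + 1 + m) (blkI B)).flatten by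
        rw [levX, if_pos hpar, levI, hB, hn],
      flatten_rep_split3 (blkI B) j m]
    nth_rewrite 2 [show blkI B = _ from hir ▸ blkI_splitQC i r]
    simp only [hPRE, hMID, hPOST, List.append_assoc, List.cons_append]
  have hPD : PD 0 MID := by
    rw [hMID]
    exact PD_append (PD_replicate_push 0 i) (e := i) (by simp [List.count_replicate])
      (PD_replicate_pop le_rfl)
  have hbal : MID.count pop = MID.count push := by simp [hMID, List.count_replicate]
  have hmem := mem_lifoArcs_match PRE MID POST 0 [] hPD hbal
  rw [← hdec] at hmem
  have h1 : PRE.length = base L lam + 3 * B * j + B + r := by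
    simp [hPRE, base, length_levels_lt _ (length_levX hL par)]
    rw [hir]; ring
  have h2 : MID.length = i + i := by
    simp only [hMID, List.length_append, List.length_replicate]
  rw [zero_add, h1, h2] at hmem
  convert hmem using 2
  omega

/-- (A1, level 0) on `A = trX 0`: initial push of token `x` → its P-pop at level 0 (`2^L = x + 1 + q`). -/
theorem arcInit_coord (hL : 1 ≤ L) {x q : ℕ} (hxq : 2 ^ L = x + 1 + q) :
    (x, 2 ^ L + q) ∈ lifoArcs (trX L 0) 0 [] := by
  have h2L : 0 < 2 * L := by omega
  set PRE := List.replicate x push with hPRE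
  set MID := List.replicate q push ++ List.replicate q pop with hMID
  set POST := (List.replicate x pop ++ List.replicate (2 ^ L) push ++ List.replicate (2 ^ L) pop) ++
    ((List.range (2 * L - 0 - 1)).map (fun k => levX L 0 (0 + 1 + k))).flatten ++
    List.replicate (padLen L) skip with hPOST
  have hlev0 : levX L 0 0 = blkI (2 ^ L) := by
    rw [levX, if_pos rfl, levI, nblk, bsz]
    simp
  have hdec : trX L 0 = PRE ++ push :: (MID ++ pop :: POST) := by
    rw [trX, flatten_range_split (levX L 0) h2L, hlev0, initX, if_pos rfl]
    rw [show blkI (2 ^ L) = List.replicate q pop ++ pop ::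
        (List.replicate x pop ++ List.replicate (2 ^ L) push ++ List.replicate (2 ^ L) pop) by
      rw [blkI]; nth_rewrite 1 [hxq]; rw [rep_split' pop x q]
      simp only [List.append_assoc, List.cons_append]]
    nth_rewrite 1 [hxq]; rw [rep_split push x q]
    simp only [hPRE, hMID, hPOST, List.append_assoc, List.cons_append, List.nil_append,
      List.range_zero, List.map_nil, List.flatten_nil]
  have hPD : PD 0 MID := by
    rw [hMID]
    exact PD_append (PD_replicate_push 0 q) (e := q) (by simp [List.count_replicate])
      (PD_replicate_pop le_rfl)
  have hbal : MID.count pop = MID.count push := by simp [hMID, List.count_replicate]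
  have hmem := mem_lifoArcs_match PRE MID POST 0 [] hPD hbal
  rw [← hdec] at hmem
  have h1 : PRE.length = x := by simp [hPRE]
  have h2 : MID.length = q + q := by
    simp only [hMID, List.length_append, List.length_replicate]
  rw [zero_add, h1, h2] at hmem
  convert hmem using 2
  omega

end Arcs

end TSB

end Summit.PneNP.PneNP.Theorems.RootDecompSegregatorSmallSegregators.Negative
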